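import Literature.Analysis.FluidPDE.ClassicalSolution
import Literature.Analysis.FluidPDE.LerayHopf
import Literature.Analysis.FluidPDE.NSWave0
import HarnessLib

/-!
# Leslie–Shvydkoy 2018: the Morrey-type ball-energy bound at a first blow-up time under a
# power-law ("Type-`q`") sup rate (Prop. 3.2 + Prop. 4.2), and its no-atom consequence

Analysis/FluidPDE statement file. Source: T. M. Leslie, R. Shvydkoy, *The energy measure for
the Euler and Navier–Stokes equations*, Arch. Ration. Mech. Anal. 230 (2018) 459–492,
arXiv:1705.04420 [`LeslieShvydkoy2017`]. Materialised text: `lit read arxiv:1705.04420`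
(pp. 3, 5, 9, 13 read; numbering of the arXiv version = journal version).

THE PRINTED RESULTS. **Prop. 3.2** (p. 9, Euler, any `n ≥ 3`): «Suppose `u` is a solution to the
Euler equation which is regular on `[-1,0)` and satisfies the bound `‖u(t,·)‖_{L^∞} ≤ c₀|t|^{-1/q}`,
`(n+2)/n ≤ q`. Then there exists a constant `C = C(u,n,q)` such that
`sup_{-1<t<0, x₀ ∈ ℝⁿ} ∫_{|x-x₀|<r} |u(x,t)|² dx ≤ C r^{n - 2/(q-1)}`.» **Prop. 4.2** (p. 13):
«Propositions 3.1 and 3.2 remain valid for solutions of 3D Navier–Stokes equation, where `0` is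
the first time of blowup.» Standing class (§1, p. 3): `u₀ ∈ H^{n/2+1+ε}(ℝⁿ)`, `u` the unique
strong solution in `C([t₀,t₁); H^{n/2+1+ε})`, pressure `p = R_i R_j(u_i u_j)`, `t₀ = -1`, `t₁ = 0`
the first blow-up time, `ν > 0`, `n = 3` for Navier–Stokes (then `u` is Leray–Hopf). In Morrey
language (Remark 3.3, p. 9): `u ∈ L^∞_t 𝓜^{2, n - 2/(q-1)}`; for `n = 3` the rate index
`3 - 2/(q-1)` is `> 0` iff `q > 5/3`, `= 0` at the admissibility endpoint `q = (n+2)/n = 5/3`,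
and `= 1` (Type I in space, `sup r⁻¹∫_{B_r}|u|² < ∞`) at the Type-I rate `q = 2` (whence the
paper's Thm 1.2, energy equality at a Type-I first blow-up).

THIS FILE.
* `leslieShvydkoy2018_morreyBound` — Prop. 3.2 + 4.2 for the 3D Navier–Stokes equations as a
  named fact, RENDERED ON THE TREE'S FIRST-BLOW-UP FRAME (the frame of the residual
  `TypeIliouvilleNoTypeII` of the summit NavierStokesRegularity and of the §B sketch
  `NoEnergyAtom` / `SubCascadeRateNoAtom`, planner ns-plan-lens-transfer-typeII, K-READ 05):
  a maximal smooth solution `(u,p)` on `[0,T)` (`IsMaximalSmoothSolution ν 0 u p T`, so `T` is the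
  first blow-up time), Leray–Hopf from its datum (`IsLerayHopfOn T ν 0 (u 0) u`), the datum
  rapidly decaying (`HasRapidSpatialDecay (u 0)`, so `u 0 ∈ H^{5/2+ε}` and `u` is the paper's
  strong solution by uniqueness), with the sup rate `‖u(t,x)‖ ≤ c₀ (T-t)^{-1/q}` on `[0,T)`,
  `5/3 ≤ q`; conclusion `∫_{B(x₀,r)} |u(t)|² ≤ C r^{3-2/(q-1)}` for all `t ∈ ]0,T[`, `x₀`, `r > 0`.
  The passage from the paper's normalisation (`[-1,0)`, blow-up at `0`) to `[0,T)` is the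
  Navier–Stokes scaling `u ↦ √T u(T + T·, √T·)` composed with a time shift, under which the
  hypothesis is invariant up to the constant `c₀` and the conclusion up to `C` (both depend on
  `u` anyway: `C = C(u,n,q)` in print). This is a SPECIAL CASE of the printed statement (smaller
  data class), not a strengthening. The ball energy is written as the lower Lebesgue integral
  `∫⁻ ‖u t y‖ₑ²` (no integrability side condition; it is the Bochner `∫ |u|²` for the frame's
  `L²` slices).
* PROVED consequences used by the §B bookkeeping: `morreyExponent_pos_iff` (`0 < 3 - 2/(q-1) ↔
  5/3 < q` for `1 < q`, i.e. sup-rate exponent `β = 1/q < 3/5`), and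
  `noConcentration_of_ballEnergy_le_rpow` — a ball-energy bound `≤ C r^θ` with `θ > 0`, uniform
  in `t ∈ S` and `x₀`, forces uniform smallness of the energy in small balls (the energy measure
  at the blow-up time has no atoms and, more, `{|u(t)|² dx}` is tight at small scales); combined:
  `leslieShvydkoy2018_morreyBound.noConcentration` (under the fact, a first blow-up with sup
  rate `β = 1/q`, `5/3 < q`, has `∀ ε > 0, ∃ r > 0, ∀ t ∈ ]0,T[, ∀ x₀, ∫_{B(x₀,r)}|u(t)|² ≤ ε`).

NOT TYPED: Prop. 3.1 (the `L^{q,*}L^p` version on domains, p. 9), Prop. 3.2 for Euler in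
general dimension (no consumer; the Euler classical-solution frame of the tree is
`IsClassicalEulerSolutionOn`, a later file can add it verbatim), Thm 1.2 (energy equality at a
Type-I blow-up; the tree has the Type-I scaled-energy bound `scaledEnergies_bounded_of_typeIRate`).

Nothing here asserts anything about Navier–Stokes regularity beyond the cited, printed bound.
-/

noncomputable section

open MeasureTheory Set Filter Topology Metric Function
open scoped ENNReal NNReal

namespace Literature.Analysis.FluidPDE

/-! ## The named fact -/

/-- **Leslie–Shvydkoy 2018, Prop. 3.2 with Prop. 4.2 (3D Navier–Stokes, first blow-up time,
power-law sup rate).** «Suppose `u` is a solution … which is regular on `[-1,0)` and satisfies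
the bound `‖u(t,·)‖_{L^∞} ≤ c₀|t|^{-1/q}`, `(n+2)/n ≤ q`. Then there exists a constant
`C = C(u,n,q)` such that `sup_{-1<t<0, x₀∈ℝⁿ} ∫_{|x-x₀|<r}|u(x,t)|² dx ≤ C r^{n-2/(q-1)}`»
(Prop. 3.2), and «Propositions 3.1 and 3.2 remain valid for solutions of 3D Navier–Stokes
equation, where `0` is the first time of blowup» (Prop. 4.2). Rendered with `n = 3` on the
tree's first-blow-up frame `[0,T)` (maximal smooth solution, Leray–Hopf from a rapidly decaying
datum — a subclass of the paper's `H^{5/2+ε}` strong solutions), time-normalised by the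
Navier–Stokes scaling (constants `c₀`, `C` absorb `T`; `C` depends on `u` in print).
[cite: LeslieShvydkoy2017, Prop. 3.2 (p. 9) and Prop. 4.2 (p. 13)] -/
def leslieShvydkoy2018_morreyBound : Prop :=
  ∀ (ν T q : ℝ), 0 < ν → 0 < T → (5 : ℝ) / 3 ≤ q →
    ∀ (u : ℝ → EuclideanSpace ℝ (Fin 3) → EuclideanSpace ℝ (Fin 3))
      (p : ℝ → EuclideanSpace ℝ (Fin 3) → ℝ),
      IsMaximalSmoothSolution ν 0 u p T → IsLerayHopfOn T ν 0 (u 0) u →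
      HasRapidSpatialDecay (u 0) →
      (∃ c₀ : ℝ, ∀ t ∈ Ico 0 T, ∀ x, ‖u t x‖ ≤ c₀ * (T - t) ^ (-(1 / q))) →
      ∃ C : ℝ, ∀ t ∈ Ioo 0 T, ∀ (x₀ : EuclideanSpace ℝ (Fin 3)) (r : ℝ), 0 < r →
        ∫⁻ y in ball x₀ r, ‖u t y‖ₑ ^ 2 ≤ ENNReal.ofReal (C * r ^ (3 - 2 / (q - 1)))

/-! ## Proved consequences -/

/-- The Morrey rate index of Prop. 3.2 at `n = 3` is positive exactly above the admissibility
endpoint: for `1 < q`, `0 < 3 - 2/(q-1) ↔ 5/3 < q` (sup-rate exponent `β = 1/q < 3/5`).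
[cite: LeslieShvydkoy2017, Prop. 3.1–3.2 and the sentence after (3.3) (p. 9)] -/
theorem morreyExponent_pos_iff {q : ℝ} (hq : 1 < q) :
    0 < 3 - 2 / (q - 1) ↔ 5 / 3 < q := by
  have hq1 : 0 < q - 1 := by linarith
  rw [sub_pos, div_lt_iff₀ hq1]
  constructor <;> intro h <;> linarith

/-- At the Type-I rate `q = 2` the index is `1` (Type I in space, Remark 3.3).
[cite: LeslieShvydkoy2017, Remark 3.3 (p. 9)] -/
theorem morreyExponent_two : (3 : ℝ) - 2 / (2 - 1) = 1 := by norm_num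

/-- **A power-law ball-energy bound with positive exponent leaves no room for concentration.**
If `∫_{B(x₀,r)} ‖v t‖² ≤ C r^θ` for all `t ∈ S`, all centres `x₀` and all radii `r > 0`, with
`θ > 0`, then for every `ε > 0` there is `r > 0` with `∫_{B(x₀,r)} ‖v t‖² ≤ ε` for all `t ∈ S`
and all `x₀` (take `r` with `C r^θ ≤ ε`). [folklore] -/
private theorem noConcentration_of_ballEnergy_le_rpow {S : Set ℝ}
    {v : ℝ → EuclideanSpace ℝ (Fin 3) → EuclideanSpace ℝ (Fin 3)} {C θ : ℝ} (hθ : 0 < θ)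
    (h : ∀ t ∈ S, ∀ (x₀ : EuclideanSpace ℝ (Fin 3)) (r : ℝ), 0 < r →
      ∫⁻ y in ball x₀ r, ‖v t y‖ₑ ^ 2 ≤ ENNReal.ofReal (C * r ^ θ)) :
    ∀ ε : ℝ, 0 < ε → ∃ r : ℝ, 0 < r ∧ ∀ t ∈ S, ∀ x₀ : EuclideanSpace ℝ (Fin 3),
      ∫⁻ y in ball x₀ r, ‖v t y‖ₑ ^ 2 ≤ ENNReal.ofReal ε := by
  intro ε hε
  by_cases hC : C ≤ 0
  · -- the bound is `≤ ofReal (nonpositive) = 0`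
    refine ⟨1, one_pos, fun t ht x₀ => (h t ht x₀ 1 one_pos).trans ?_⟩
    rw [ENNReal.ofReal_of_nonpos (mul_nonpos_of_nonpos_of_nonneg hC (by positivity))]
    exact zero_le
  · push Not at hC
    -- `r = min 1 ((ε / C)^(1/θ))` has `C r^θ ≤ ε`
    set r : ℝ := min 1 ((ε / C) ^ (1 / θ)) with hr
    have hεC : 0 < ε / C := div_pos hε hC
    have hr0 : 0 < r := lt_min one_pos (Real.rpow_pos_of_pos hεC _)
    refine ⟨r, hr0, fun t ht x₀ => (h t ht x₀ r hr0).trans (ENNReal.ofReal_le_ofReal ?_)⟩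
    have hrle : r ≤ (ε / C) ^ (1 / θ) := min_le_right _ _
    have hpow : r ^ θ ≤ ((ε / C) ^ (1 / θ)) ^ θ :=
      Real.rpow_le_rpow hr0.le hrle hθ.le
    rw [← Real.rpow_mul hεC.le, one_div_mul_cancel hθ.ne', Real.rpow_one] at hpow
    calc C * r ^ θ ≤ C * (ε / C) := by gcongr
      _ = ε := by field_simp

/-- **No energy concentration at a first blow-up with a sub-`5/3` power rate** (consequence of
the fact): under `leslieShvydkoy2018_morreyBound`, a first blow-up of the frame with sup rate
`‖u(t)‖_∞ ≤ c₀ (T-t)^{-1/q}`, `5/3 < q` (i.e. rate exponent `β = 1/q < 3/5`), satisfies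
`∀ ε > 0, ∃ r > 0, ∀ t ∈ ]0,T[, ∀ x₀, ∫_{B(x₀,r)} |u(t)|² ≤ ε` — the energy measure at time `T`
has no atoms (indeed its upper `θ`-density is bounded, §1.3 of the paper).
[cite: LeslieShvydkoy2017, Prop. 3.2 + 4.2 (pp. 9, 13) with §1.3 (p. 5, local dimension `≥ β`)] -/
theorem leslieShvydkoy2018_morreyBound.noConcentration (hLS : leslieShvydkoy2018_morreyBound)
    {ν T q : ℝ} (hν : 0 < ν) (hT : 0 < T) (hq : 5 / 3 < q)
    {u : ℝ → EuclideanSpace ℝ (Fin 3) → EuclideanSpace ℝ (Fin 3)}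
    {p : ℝ → EuclideanSpace ℝ (Fin 3) → ℝ}
    (hmax : IsMaximalSmoothSolution ν 0 u p T) (hLH : IsLerayHopfOn T ν 0 (u 0) u)
    (hdec : HasRapidSpatialDecay (u 0))
    (hrate : ∃ c₀ : ℝ, ∀ t ∈ Ico 0 T, ∀ x, ‖u t x‖ ≤ c₀ * (T - t) ^ (-(1 / q))) :
    ∀ ε : ℝ, 0 < ε → ∃ r : ℝ, 0 < r ∧ ∀ t ∈ Ioo 0 T, ∀ x₀ : EuclideanSpace ℝ (Fin 3),
      ∫⁻ y in ball x₀ r, ‖u t y‖ₑ ^ 2 ≤ ENNReal.ofReal ε := by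
  obtain ⟨C, hC⟩ := hLS ν T q hν hT hq.le u p hmax hLH hdec hrate
  have hθ : 0 < 3 - 2 / (q - 1) := (morreyExponent_pos_iff (by linarith)).2 hq
  exact noConcentration_of_ballEnergy_le_rpow hθ hC

end Literature.Analysis.FluidPDE
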